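import Literature.Barriers.QuantumAdvantage.FFKLGenericCollapse
import Literature.Computability.Complexity.OracleRunPolynomials
import Literature.Computability.Complexity.ApproxDegreeCertificates
import HarnessLib

/-!
# The window of a categorical `AWPP^{B ⊕ ·}` description: its acceptance function is a Boolean function of polynomial block sensitivity and certificate complexity (Fenner–Fortnow–Kurtz–Li, Thm. 6.13)

Support file for the named fact
`Literature.Barriers.QuantumAdvantage.fennerFortnowKurtzLi2003_thm618_awpp` (Fenner–Fortnow–
Kurtz–Li, *An oracle builder's toolkit*, Inform. and Comput. 182 (2003), Thm. 6.18 (2)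
rerelativized), continuing `FFKLGenericCollapse.lean` (descriptions `AWPPDescr`, their gap,
promise, language, `WellFormed`, `Categorical B σ`, locality `gap_congr`). This file is the
MATHEMATICAL BRIDGE between a description categorical over a finite Cohen condition `σ` and the
Boolean-function toolkit of the Standard Algorithm (`ApproxDegreeCertificates.lean`,
`StandardAlgorithm.lean`): the printed **Thm. 6.13** ("AWPP has polynomial certificate
complexity"), p. 31–32: "Suppose `M` is categorical over a partial function `σ`. Fix an input `x` of
length `n`. For all `y ∈ {0,1}^{2^{nᵏ+1}-1}` extending `σ` … define the function `f(y)` to be `1`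
when `M^y(x)` accepts and `0` when `M^y(x)` rejects. Let … `h(y)` be from Lemma 6.12. Define
`p(y) … as h(y)/2^{q(n)}`. The degree of `p(y)` is bounded by `nᵏ` by Lemma 6.12, and … we have
`|f(y) - p(y)| ≤ 1/3`. So we can apply Theorem 6.11 with `N = 2^{nᵏ+1} - 1 - |dom σ ∩ Σ^{≤ nᵏ}|`
to get the certificate complexity of `f` to be polynomial in `n`."

* `AWPPDescr.reach Δ n` — the common fuel (= query-length) bound `nᵏ` of the two machines on the
  witnesses `⟨x, y⟩` of an input of length `n`; `AWPPDescr.window Δ σ n` — the strings of length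
  `≤ reach n` outside `dom σ` (the `N` variables), enumerated by `AWPPDescr.winEnum`;
* `AWPPDescr.windowOracle Δ σ n w` — the oracle `y` of a window assignment `w` (window strings set
  by `w`, `dom σ` set by `σ`, everything else negative), which extends `σ`
  (`extendedBy_windowOracle`); `AWPPDescr.windowView` — the same oracle joined with `B` as a VIEW in
  the sense of `OracleRunPolynomials.lean` (`viewOracle_windowView`: window strings are variables,
  `B` and `σ` are constants);
* `AWPPDescr.winFn Δ B σ x` — the Boolean function `f` of Thm. 6.13 (`w ↦ [x ∈ L(Δ^{B ⊕ y_w})]`) and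
  `AWPPDescr.gapPolyAt` — the real polynomial `p = h/2^{q(n)}` of the window variables; PROVED:
  `eval_gapPolyAt` (it evaluates to `gap/2^p`, by `OracleAlg.eval_gapPoly`, Lemma 6.12),
  `totalDegree_gapPolyAt_le` (degree `≤ reach n`), and, for `Δ` categorical over `σ`, the bounds
  `gapPolyAt_mem_Icc`, `gapPolyAt_le_of_winFn_false`, `le_gapPolyAt_of_winFn_true` (the promise),
  whence **`blockSensitivity_winFn_le`** (`bs(f) ≤ 4·reach²`) and **`exists_certificate_winFn`**
  (every assignment has a certificate of size `≤ 16·reach⁴`) by Nisan–Szegedy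
  (`ApproxDegreeCertificates.lean`, Thm. 6.11);
* the bridge to arbitrary oracles extending `σ` (for well-formed `Δ`: its machines read only
  strings of length `≤ reach n` of the `Z`-part, `zQueries_length_le`): `AWPPDescr.windowOf` reads
  the window assignment off `Z`, `gap_windowOracle_windowOf` and **`mem_lang_iff_winFn`**
  (`x ∈ L(Δ^{B ⊕ Z}) ↔ f(window of Z) = 1`).

No machines and no complexity classes are involved here; the consumers are the certificate test of
Lemma 6.17 and the Standard Algorithm (sibling files).

## References

* [FennerFortnowKurtzLi2003IC] Lemma 6.12, Thm. 6.13 (pp. 31–32), §6.5 (p. 32), Lemma 6.17 (p. 33),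
  read via `lit read doi:10.1016/s0890-5401(03)00018-x --pages 25-34`.
* [BealsEtAl2001] Thm. 4.13, Lemma 5.2 (the analytic core, via `ApproxDegreeCertificates.lean`).
-/

noncomputable section

namespace Literature.Barriers.QuantumAdvantage

open _root_.Computability Literature.Computability.Complexity Literature.Computability.Complexity.Classes
  Literature.Computability.Complexity.CohenCondition Literature.Computability.QuantumComplexity Finset
  MvPolynomial

namespace AWPPDescr

variable (Δ : AWPPDescr) (B : Language Bool) (σ : CohenCondition)

/-! ### Reach, window, enumeration -/

/-- The fuel of `M₁` on the witnesses `⟨x, y⟩`, `|y| = r₁(n)`, of an input of length `n`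
(`|⟨x, y⟩| = 2n + 2 + r₁(n)`). [cite: FennerFortnowKurtzLi2003IC, §6.4 (p. 31, "M runs in time nᵏ")] -/
def fuel₁ (n : ℕ) : ℕ := Δ.q₁.eval (2 * n + 2 + Δ.r₁.eval n)

/-- The fuel of `M₂` on the witnesses of an input of length `n`. [cite: FennerFortnowKurtzLi2003IC, §6.4 (p. 31)] -/
def fuel₂ (n : ℕ) : ℕ := Δ.q₂.eval (2 * n + 2 + Δ.r₂.eval n)

/-- **The reach** `nᵏ`: a common bound on the fuels, hence (for well-formed descriptions) on the
lengths of all queries of both machines on the witnesses of an input of length `n`.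
[cite: FennerFortnowKurtzLi2003IC, §6.4 (p. 31, "the length of each oracle query is also bounded by nᵏ")] -/
def reach (n : ℕ) : ℕ := max (Δ.fuel₁ n) (Δ.fuel₂ n)

open scoped Classical in
/-- **The window**: the strings of length `≤ reach n` outside `dom σ` — the variables `y_w` of
Thm. 6.13 (`N = 2^{nᵏ+1} - 1 - |dom σ ∩ Σ^{≤ nᵏ}|` of them). [cite: FennerFortnowKurtzLi2003IC, Thm. 6.13 (proof, p. 32)] -/
def window (n : ℕ) : Finset (List Bool) :=
  (List.finite_length_le Bool (Δ.reach n)).toFinset.filter fun t => t ∉ σ.dom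

/-- Membership in the window. [cite: FennerFortnowKurtzLi2003IC, Thm. 6.13 (proof, p. 32)] -/
theorem mem_window {n : ℕ} {t : List Bool} : t ∈ Δ.window σ n ↔ t.length ≤ Δ.reach n ∧ t ∉ σ.dom := by
  classical
  simp [window, Set.Finite.mem_toFinset]

/-- The number `N` of window variables. [cite: FennerFortnowKurtzLi2003IC, Thm. 6.13 (proof, p. 32)] -/
def winCard (n : ℕ) : ℕ := (Δ.window σ n).card

/-- An enumeration of the window by `Fin N`. [folklore] -/
def winEnum (n : ℕ) : Fin (Δ.winCard σ n) ≃ Δ.window σ n := (Δ.window σ n).equivFin.symm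

/-- Enumerated strings lie in the window. [folklore] -/
theorem winEnum_mem (n : ℕ) (i : Fin (Δ.winCard σ n)) : ((Δ.winEnum σ n i : Δ.window σ n) : List Bool) ∈ Δ.window σ n :=
  (Δ.winEnum σ n i).2

/-- Enumerated strings are outside `dom σ`. [folklore] -/
theorem val_winEnum (n : ℕ) (i : Fin (Δ.winCard σ n)) : σ.val ((Δ.winEnum σ n i : Δ.window σ n) : List Bool) = none := by
  have h := ((Δ.mem_window σ).1 (Δ.winEnum_mem σ n i)).2
  rwa [mem_dom_iff, not_not] at h

/-- Enumerated strings are short. [folklore] -/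
theorem length_winEnum_le (n : ℕ) (i : Fin (Δ.winCard σ n)) :
    ((Δ.winEnum σ n i : Δ.window σ n) : List Bool).length ≤ Δ.reach n :=
  ((Δ.mem_window σ).1 (Δ.winEnum_mem σ n i)).1

/-! ### The oracle of a window assignment, and its view -/

/-- **The oracle `y_w` of a window assignment `w`**: the window strings set by `w`, the strings of
`dom σ` set by `σ` ("`y` extending `σ`, i.e. `∀ w ∈ dom(σ), y_w = σ(w)` is fixed"), all other
strings negative. [cite: FennerFortnowKurtzLi2003IC, Thm. 6.13 (proof, p. 31)] -/
def windowOracle (n : ℕ) (w : Fin (Δ.winCard σ n) → Bool) : Language Bool :=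
  {t | (∃ i, ((Δ.winEnum σ n i : Δ.window σ n) : List Bool) = t ∧ w i = true) ∨ σ.val t = some true}

variable {σ} in
/-- Unfolding of membership in `y_w`. [cite: FennerFortnowKurtzLi2003IC, Thm. 6.13 (proof, p. 31)] -/
theorem mem_windowOracle_iff {n : ℕ} (w : Fin (Δ.winCard σ n) → Bool) (t : List Bool) :
    t ∈ Δ.windowOracle σ n w ↔
      (∃ i, ((Δ.winEnum σ n i : Δ.window σ n) : List Bool) = t ∧ w i = true) ∨ σ.val t = some true :=
  Iff.rfl

variable {σ} in
/-- A window string is in `y_w` iff its variable is set. [cite: FennerFortnowKurtzLi2003IC, Thm. 6.13 (proof, p. 31)] -/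
theorem mem_windowOracle_of_mem_window {n : ℕ} (w : Fin (Δ.winCard σ n) → Bool) {t : List Bool}
    (ht : t ∈ Δ.window σ n) : t ∈ Δ.windowOracle σ n w ↔ w ((Δ.winEnum σ n).symm ⟨t, ht⟩) = true := by
  have hσ : σ.val t = none := by
    have h := ((Δ.mem_window σ).1 ht).2
    rwa [mem_dom_iff, not_not] at h
  rw [Δ.mem_windowOracle_iff w t, hσ]
  constructor
  · rintro (⟨i, hi, hw⟩ | h)
    · have : Δ.winEnum σ n i = ⟨t, ht⟩ := Subtype.ext hi
      rwa [← this, Equiv.symm_apply_apply]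
    · cases h
  · intro hw
    exact Or.inl ⟨(Δ.winEnum σ n).symm ⟨t, ht⟩, by rw [Equiv.apply_symm_apply], hw⟩

variable {σ} in
/-- Outside the window, `y_w` follows `σ` (negative where `σ` is undefined). [cite: FennerFortnowKurtzLi2003IC, Thm. 6.13 (proof, p. 31)] -/
theorem mem_windowOracle_of_not_mem_window {n : ℕ} (w : Fin (Δ.winCard σ n) → Bool) {t : List Bool}
    (ht : t ∉ Δ.window σ n) : t ∈ Δ.windowOracle σ n w ↔ σ.val t = some true := by
  rw [Δ.mem_windowOracle_iff w t]
  constructor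
  · rintro (⟨i, hi, -⟩ | h)
    · exact absurd (hi ▸ Δ.winEnum_mem σ n i) ht
    · exact h
  · exact fun h => Or.inr h

/-- **`y_w` extends `σ`.** [cite: FennerFortnowKurtzLi2003IC, Thm. 6.13 (proof, p. 31)] -/
theorem extendedBy_windowOracle (n : ℕ) (w : Fin (Δ.winCard σ n) → Bool) : σ.ExtendedBy (Δ.windowOracle σ n w) := by
  intro t b hb
  have ht : t ∉ Δ.window σ n := fun ht => by
    have := ((Δ.mem_window σ).1 ht).2
    rw [mem_dom_iff, hb] at this
    exact this (Option.some_ne_none b)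
  rw [Δ.mem_windowOracle_of_not_mem_window w ht, hb, Option.some.injEq]

/-- **The view of `B ⊕ y_w`**: a query `1t` with `t` in the window reads the variable of `t`; every
other query reads a constant (`B` on `0t`, `σ` or "no" on the remaining `1t`, "no" on the empty
query). [cite: FennerFortnowKurtzLi2003IC, Lemma 6.12 (p. 31) and Thm. 6.13 (proof)] -/
def windowView (n : ℕ) : List Bool → Fin (Δ.winCard σ n) ⊕ Bool
  | [] => Sum.inr false
  | false :: t => Sum.inr (B.boolIndicator t)
  | true :: t =>
    if h : t ∈ Δ.window σ n then Sum.inl ((Δ.winEnum σ n).symm ⟨t, h⟩)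
    else Sum.inr (decide (σ.val t = some true))

/-- The oracle of a language, read through a membership equivalence. [folklore] -/
theorem ofLanguage_eq_encodeBool_of_iff {L : Language Bool} {s : List Bool} {b : Bool} (h : s ∈ L ↔ b = true) :
    Oracle.ofLanguage L s = encodeBool b := by
  rw [Oracle.ofLanguage_apply]
  cases b
  · rw [(Set.notMem_iff_boolIndicator _ _).1 fun hs => Bool.false_ne_true (h.1 hs)]
  · rw [(Set.mem_iff_boolIndicator _ _).1 (h.2 rfl)]

/-- **The view reads `B ⊕ y_w`**: the bit read by a query under the view at `w` is its membership
in `B ⊕ y_w`. [cite: FennerFortnowKurtzLi2003IC, Lemma 6.12 (p. 31) and Thm. 6.13 (proof)] -/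
theorem mem_oracleJoin_windowOracle_iff_viewBit (n : ℕ) (w : Fin (Δ.winCard σ n) → Bool) (s : List Bool) :
    s ∈ oracleJoin B (Δ.windowOracle σ n w) ↔ OracleAlg.viewBit (Δ.windowView B σ n) w s = true := by
  rcases s with _ | ⟨b, t⟩
  · rw [OracleAlg.viewBit_of_inr (show Δ.windowView B σ n [] = Sum.inr false from rfl)]
    simp
  · cases b
    · rw [OracleAlg.viewBit_of_inr (show Δ.windowView B σ n (false :: t) = Sum.inr (B.boolIndicator t) from rfl),
        false_cons_mem_oracleJoin]
      exact Set.mem_iff_boolIndicator _ _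
    · by_cases ht : t ∈ Δ.window σ n
      · rw [OracleAlg.viewBit_of_inl (show Δ.windowView B σ n (true :: t) = Sum.inl ((Δ.winEnum σ n).symm ⟨t, ht⟩) from
          dif_pos ht), true_cons_mem_oracleJoin, Δ.mem_windowOracle_of_mem_window w ht]
      · rw [OracleAlg.viewBit_of_inr (show Δ.windowView B σ n (true :: t) = Sum.inr (decide (σ.val t = some true)) from
          dif_neg ht), true_cons_mem_oracleJoin, Δ.mem_windowOracle_of_not_mem_window w ht]
        exact decide_eq_true_iff.symm

/-- **The view presents `B ⊕ y_w`**: at the window assignment `w`, the oracle of the view is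
`Oracle.ofLanguage (B ⊕ y_w)`. [cite: FennerFortnowKurtzLi2003IC, Lemma 6.12 (p. 31) and Thm. 6.13 (proof)] -/
theorem viewOracle_windowView (n : ℕ) (w : Fin (Δ.winCard σ n) → Bool) :
    OracleAlg.viewOracle (Δ.windowView B σ n) w = Oracle.ofLanguage (oracleJoin B (Δ.windowOracle σ n w)) := by
  funext s
  exact (ofLanguage_eq_encodeBool_of_iff (Δ.mem_oracleJoin_windowOracle_iff_viewBit B σ n w s)).symm

/-! ### The acceptance function and the gap polynomial of an input -/

/-- **The acceptance function `f` of the input `x`** (Thm. 6.13: "`f(y)` is `1` when `M^y(x)`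
accepts and `0` when `M^y(x)` rejects"), as a Boolean function of the window assignment:
`w ↦ [x ∈ L(Δ^{B ⊕ y_w})]`. [cite: FennerFortnowKurtzLi2003IC, Thm. 6.13 (proof, p. 31)] -/
def winFn (x : List Bool) (w : Fin (Δ.winCard σ x.length) → Bool) : Bool :=
  (Δ.lang B (Δ.windowOracle σ x.length w)).boolIndicator x

/-- Unfolding of `winFn`. [cite: FennerFortnowKurtzLi2003IC, Thm. 6.13 (proof, p. 31)] -/
theorem winFn_eq_true_iff (x : List Bool) (w : Fin (Δ.winCard σ x.length) → Bool) :
    Δ.winFn B σ x w = true ↔ x ∈ Δ.lang B (Δ.windowOracle σ x.length w) :=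
  (Set.mem_iff_boolIndicator _ _).symm

/-- **The polynomial `p = h/2^{q(n)}` of the input `x`** (Lemma 6.12 / Thm. 6.13): the gap
polynomial of the two machines over the witnesses of `x`, under the window view, divided by
`2^{p(|x|)}`; real coefficients. [cite: FennerFortnowKurtzLi2003IC, Lemma 6.12 (p. 31) and Thm. 6.13 (proof)] -/
def gapPolyAt (x : List Bool) : MvPolynomial (Fin (Δ.winCard σ x.length)) ℝ :=
  C (((2 : ℝ) ^ Δ.p.eval x.length)⁻¹) *
    OracleAlg.gapPoly Δ.M₁ Δ.M₂ (Δ.windowView B σ x.length) (Δ.fuel₁ x.length) (Δ.fuel₂ x.length)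
      (fun y : List.Vector Bool (Δ.r₁.eval x.length) => boolPair x y.toList)
      (fun y : List.Vector Bool (Δ.r₂.eval x.length) => boolPair x y.toList)

/-- The first count at `y_w` is the number of accepted witnesses under the view. [cite: FennerFortnowKurtzLi2003IC, Lemma 6.12 (p. 31)] -/
theorem card_filter_run₁ (x : List Bool) (w : Fin (Δ.winCard σ x.length) → Bool) :
    ((univ : Finset (List.Vector Bool (Δ.r₁.eval x.length))).filter fun y =>
        Δ.M₁.run (OracleAlg.viewOracle (Δ.windowView B σ x.length) w) (Δ.fuel₁ x.length) (boolPair x y.toList) =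
          some true).card = Δ.cnt₁ B (Δ.windowOracle σ x.length w) x := by
  classical
  unfold cnt₁ countWitnesses
  congr 1
  ext y
  simp only [Finset.mem_filter, Finset.mem_univ, true_and, Δ.viewOracle_windowView B σ]
  show _ ↔ Δ.acc₁ B _ _
  rw [acc₁, length_boolPair, List.Vector.toList_length, fuel₁]

/-- The second count likewise. [cite: FennerFortnowKurtzLi2003IC, Lemma 6.12 (p. 31)] -/
theorem card_filter_run₂ (x : List Bool) (w : Fin (Δ.winCard σ x.length) → Bool) :
    ((univ : Finset (List.Vector Bool (Δ.r₂.eval x.length))).filter fun y =>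
        Δ.M₂.run (OracleAlg.viewOracle (Δ.windowView B σ x.length) w) (Δ.fuel₂ x.length) (boolPair x y.toList) =
          some true).card = Δ.cnt₂ B (Δ.windowOracle σ x.length w) x := by
  classical
  unfold cnt₂ countWitnesses
  congr 1
  ext y
  simp only [Finset.mem_filter, Finset.mem_univ, true_and, Δ.viewOracle_windowView B σ]
  show _ ↔ Δ.acc₂ B _ _
  rw [acc₂, length_boolPair, List.Vector.toList_length, fuel₂]

/-- **The polynomial computes the normalized gap** (Lemma 6.12): at the window assignment `w`,
`p(w) = gap(x)/2^{p(|x|)}` relative to `B ⊕ y_w`. [cite: FennerFortnowKurtzLi2003IC, Lemma 6.12 (p. 31) and Thm. 6.13 (proof)] -/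
theorem eval_gapPolyAt (x : List Bool) (w : Fin (Δ.winCard σ x.length) → Bool) :
    MvPolynomial.eval (Multilinear.boolPt (R := ℝ) w) (Δ.gapPolyAt B σ x) =
      (Δ.gap B (Δ.windowOracle σ x.length w) x : ℝ) / (2 : ℝ) ^ Δ.p.eval x.length := by
  unfold gapPolyAt
  rw [map_mul, eval_C, OracleAlg.eval_gapPoly, Δ.card_filter_run₁ B σ x w, Δ.card_filter_run₂ B σ x w, gap]
  push_cast
  ring

/-- **The degree bound** (Lemma 6.12): `deg p ≤ reach n`. [cite: FennerFortnowKurtzLi2003IC, Lemma 6.12 (p. 31)] -/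
theorem totalDegree_gapPolyAt_le (x : List Bool) : (Δ.gapPolyAt B σ x).totalDegree ≤ Δ.reach x.length := by
  unfold gapPolyAt
  refine (totalDegree_mul _ _).trans ?_
  rw [totalDegree_C, zero_add]
  exact OracleAlg.totalDegree_gapPoly_le _ _ _ _ _ _ _

/-! ### The promise: bounds for categorical descriptions -/

variable {B σ}

/-- For `Δ` categorical over `σ`, the promise holds at every `y_w`. [cite: FennerFortnowKurtzLi2003IC, Thm. 6.13 (proof, "M is categorical over σ")] -/
theorem prom_windowOracle (hcat : Δ.Categorical B σ) (x : List Bool) (w : Fin (Δ.winCard σ x.length) → Bool) :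
    Δ.Prom B (Δ.windowOracle σ x.length w) x :=
  hcat _ (Δ.extendedBy_windowOracle σ x.length w) x

/-- **`p` takes values in `[0, 1]` on the cube** (the promise `gap/2^p ∈ [0,1/3] ∪ [2/3,1]`).
[cite: FennerFortnowKurtzLi2003IC, Thm. 6.13 (proof, p. 32: "|f(y) - p(y)| ≤ 1/3") and Def. 6.1] -/
theorem gapPolyAt_mem_Icc (hcat : Δ.Categorical B σ) (x : List Bool) (w : Fin (Δ.winCard σ x.length) → Bool) :
    0 ≤ MvPolynomial.eval (Multilinear.boolPt (R := ℝ) w) (Δ.gapPolyAt B σ x) ∧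
      MvPolynomial.eval (Multilinear.boolPt (R := ℝ) w) (Δ.gapPolyAt B σ x) ≤ 1 := by
  rw [Δ.eval_gapPolyAt B σ x w]
  have hP : (0 : ℝ) < (2 : ℝ) ^ Δ.p.eval x.length := by positivity
  rcases Δ.prom_windowOracle hcat x w with ⟨h1, h2⟩ | ⟨h1, h2⟩
  · have h1' : (2 * (2 : ℝ) ^ Δ.p.eval x.length) ≤ 3 * (Δ.gap B (Δ.windowOracle σ x.length w) x : ℝ) := by
      exact_mod_cast h1
    have h2' : (Δ.gap B (Δ.windowOracle σ x.length w) x : ℝ) ≤ (2 : ℝ) ^ Δ.p.eval x.length := by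
      exact_mod_cast h2
    constructor
    · exact div_nonneg (by linarith) hP.le
    · rw [div_le_one hP]; exact h2'
  · have h1' : (0 : ℝ) ≤ (Δ.gap B (Δ.windowOracle σ x.length w) x : ℝ) := by exact_mod_cast h1
    have h2' : 3 * (Δ.gap B (Δ.windowOracle σ x.length w) x : ℝ) ≤ (2 : ℝ) ^ Δ.p.eval x.length := by
      exact_mod_cast h2
    constructor
    · exact div_nonneg h1' hP.le
    · rw [div_le_one hP]; linarith

/-- **`p ≤ 1/3` where `f = 0`.** [cite: FennerFortnowKurtzLi2003IC, Thm. 6.13 (proof, p. 32) and Def. 6.1] -/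
theorem gapPolyAt_le_of_winFn_false (hcat : Δ.Categorical B σ) (x : List Bool)
    (w : Fin (Δ.winCard σ x.length) → Bool) (hw : Δ.winFn B σ x w = false) :
    MvPolynomial.eval (Multilinear.boolPt (R := ℝ) w) (Δ.gapPolyAt B σ x) ≤ 1 / 3 := by
  rw [Δ.eval_gapPolyAt B σ x w]
  have hP : (0 : ℝ) < (2 : ℝ) ^ Δ.p.eval x.length := by positivity
  have hx : ¬ x ∈ Δ.lang B (Δ.windowOracle σ x.length w) := by
    rw [← Δ.winFn_eq_true_iff B σ x w, hw]; exact Bool.false_ne_true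
  rcases Δ.prom_windowOracle hcat x w with ⟨h1, -⟩ | ⟨-, h2⟩
  · exact absurd h1 hx
  · have h2' : 3 * (Δ.gap B (Δ.windowOracle σ x.length w) x : ℝ) ≤ (2 : ℝ) ^ Δ.p.eval x.length := by
      exact_mod_cast h2
    rw [div_le_iff₀ hP]; linarith

/-- **`p ≥ 2/3` where `f = 1`.** [cite: FennerFortnowKurtzLi2003IC, Thm. 6.13 (proof, p. 32) and Def. 6.1] -/
theorem le_gapPolyAt_of_winFn_true (hcat : Δ.Categorical B σ) (x : List Bool)
    (w : Fin (Δ.winCard σ x.length) → Bool) (hw : Δ.winFn B σ x w = true) :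
    2 / 3 ≤ MvPolynomial.eval (Multilinear.boolPt (R := ℝ) w) (Δ.gapPolyAt B σ x) := by
  rw [Δ.eval_gapPolyAt B σ x w]
  have hP : (0 : ℝ) < (2 : ℝ) ^ Δ.p.eval x.length := by positivity
  have hx : x ∈ Δ.lang B (Δ.windowOracle σ x.length w) := (Δ.winFn_eq_true_iff B σ x w).1 hw
  have h1 : 2 * (2 : ℤ) ^ Δ.p.eval x.length ≤ 3 * Δ.gap B (Δ.windowOracle σ x.length w) x := hx
  have h1' : 2 * (2 : ℝ) ^ Δ.p.eval x.length ≤ 3 * (Δ.gap B (Δ.windowOracle σ x.length w) x : ℝ) := by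
    exact_mod_cast h1
  have _ := hcat
  rw [le_div_iff₀ hP]; linarith

/-- **Thm. 6.13, block-sensitivity form**: for `Δ` categorical over `σ`, the acceptance function of
every input has block sensitivity at most `4·reach(n)²` (Nisan–Szegedy, Thm. 6.11, applied to `p`).
[cite: FennerFortnowKurtzLi2003IC, Thm. 6.13 (pp. 31–32) and Thm. 6.11 (p. 30)] -/
theorem blockSensitivity_winFn_le (hcat : Δ.Categorical B σ) (x : List Bool) :
    blockSensitivity (Δ.winFn B σ x) ≤ 4 * Δ.reach x.length ^ 2 :=
  blockSensitivity_le_four_mul_sq_of_approx (Δ.winFn B σ x) (Δ.gapPolyAt B σ x)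
    (Δ.totalDegree_gapPolyAt_le B σ x) (Δ.gapPolyAt_mem_Icc hcat x)
    (Δ.gapPolyAt_le_of_winFn_false hcat x) (Δ.le_gapPolyAt_of_winFn_true hcat x)

/-- **Thm. 6.13 ("AWPP has polynomial certificate complexity")**: for `Δ` categorical over `σ`,
every window assignment has a certificate of the acceptance function of size at most
`16·reach(n)⁴` ("there is a set `S_y` (of size at most `c(nᵏ)`) of strings of length less than or
equal to `nᵏ` such that `f(y) = f(z)` for all `z` agreeing with `y` on `S_y`").
[cite: FennerFortnowKurtzLi2003IC, Thm. 6.13 (pp. 31–32)] -/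
theorem exists_certificate_winFn (hcat : Δ.Categorical B σ) (x : List Bool)
    (w : Fin (Δ.winCard σ x.length) → Bool) :
    ∃ S : Finset (Fin (Δ.winCard σ x.length)), IsCertificate (Δ.winFn B σ x) w S ∧ S.card ≤ 16 * Δ.reach x.length ^ 4 :=
  exists_certificate_of_approx (Δ.winFn B σ x) (Δ.gapPolyAt B σ x) (Δ.totalDegree_gapPolyAt_le B σ x)
    (Δ.gapPolyAt_mem_Icc hcat x) (Δ.gapPolyAt_le_of_winFn_false hcat x) (Δ.le_gapPolyAt_of_winFn_true hcat x) w

/-- The certificate complexity form: `C(f) ≤ 16·reach(n)⁴`. [cite: FennerFortnowKurtzLi2003IC, Thm. 6.13 (pp. 31–32)] -/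
theorem certificateComplexity_winFn_le (hcat : Δ.Categorical B σ) (x : List Bool) :
    certificateComplexity (Δ.winFn B σ x) ≤ 16 * Δ.reach x.length ^ 4 :=
  certificateComplexity_le_of_approx (Δ.winFn B σ x) (Δ.gapPolyAt B σ x) (Δ.totalDegree_gapPolyAt_le B σ x)
    (Δ.gapPolyAt_mem_Icc hcat x) (Δ.gapPolyAt_le_of_winFn_false hcat x) (Δ.le_gapPolyAt_of_winFn_true hcat x)

/-! ### The bridge to oracles extending `σ` -/

variable (σ)

/-- **The window assignment read off an oracle `Z`** ("let `y` be induced by any oracle `A`, i.e.,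
`∀w, y_w = χ_A(w)`"). [cite: FennerFortnowKurtzLi2003IC, Thm. 6.13 (proof, p. 32)] -/
def windowOf (n : ℕ) (Z : Language Bool) : Fin (Δ.winCard σ n) → Bool :=
  fun i => Z.boolIndicator ((Δ.winEnum σ n i : Δ.window σ n) : List Bool)

/-- Reading off `y_w` gives back `w`. [folklore] -/
theorem windowOf_windowOracle (n : ℕ) (w : Fin (Δ.winCard σ n) → Bool) :
    Δ.windowOf σ n (Δ.windowOracle σ n w) = w := by
  funext i
  have hi : (Δ.winEnum σ n).symm ⟨_, Δ.winEnum_mem σ n i⟩ = i := by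
    rw [Equiv.symm_apply_eq]
  have h := (Set.mem_iff_boolIndicator (Δ.windowOracle σ n w) ((Δ.winEnum σ n i : Δ.window σ n) : List Bool)).symm.trans
    (Δ.mem_windowOracle_of_mem_window w (Δ.winEnum_mem σ n i))
  rw [hi] at h
  exact Bool.eq_iff_iff.2 h

variable {σ}

/-- **For `Z` extending `σ`, `y_{w(Z)}` agrees with `Z` on all strings of length `≤ reach n`.**
[cite: FennerFortnowKurtzLi2003IC, Thm. 6.13 (proof, p. 32)] -/
theorem mem_windowOracle_windowOf_iff {Z : Language Bool} (hZ : σ.ExtendedBy Z) {n : ℕ} {t : List Bool}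
    (ht : t.length ≤ Δ.reach n) : t ∈ Δ.windowOracle σ n (Δ.windowOf σ n Z) ↔ t ∈ Z := by
  classical
  by_cases hw : t ∈ Δ.window σ n
  · rw [Δ.mem_windowOracle_of_mem_window _ hw]
    unfold windowOf
    rw [Equiv.apply_symm_apply]
    exact (Set.mem_iff_boolIndicator _ _).symm
  · rw [Δ.mem_windowOracle_of_not_mem_window _ hw]
    have hdom : t ∈ σ.dom := by
      by_contra h
      exact hw ((Δ.mem_window σ).2 ⟨ht, h⟩)
    obtain ⟨b, hb⟩ := Option.ne_none_iff_exists'.1 hdom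
    rw [hZ.mem_iff hb, hb, Option.some.injEq]

/-- The `Z`-parts of the queries of a well-formed description on the witnesses of `x` have length
at most `reach |x|`. [cite: FennerFortnowKurtzLi2003IC, §6.4 (p. 31, query lengths ≤ nᵏ)] -/
theorem zQueries_length_le (hwf : Δ.WellFormed) (B Z : Language Bool) (x : List Bool) :
    ∀ t ∈ Δ.zQueries B Z x, t.length ≤ Δ.reach x.length := by
  intro t ht
  unfold zQueries at ht
  rcases Finset.mem_union.1 ht with h | h
  · obtain ⟨y, -, hy⟩ := Finset.mem_biUnion.1 h
    obtain ⟨s, hs, rfl⟩ := Finset.mem_image.1 hy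
    have hlen := (hwf.2.2.1 (Oracle.ofLanguage (oracleJoin B Z)) (boolPair x y.toList)).2 s (List.mem_toFinset.1 hs)
    rw [length_boolPair, List.Vector.toList_length] at hlen
    calc s.tail.length = s.length - 1 := List.length_tail
      _ ≤ Δ.fuel₁ x.length := by unfold fuel₁; omega
      _ ≤ Δ.reach x.length := le_max_left _ _
  · obtain ⟨y, -, hy⟩ := Finset.mem_biUnion.1 h
    obtain ⟨s, hs, rfl⟩ := Finset.mem_image.1 hy
    have hlen := (hwf.2.2.2 (Oracle.ofLanguage (oracleJoin B Z)) (boolPair x y.toList)).2 s (List.mem_toFinset.1 hs)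
    rw [length_boolPair, List.Vector.toList_length] at hlen
    calc s.tail.length = s.length - 1 := List.length_tail
      _ ≤ Δ.fuel₂ x.length := by unfold fuel₂; omega
      _ ≤ Δ.reach x.length := le_max_right _ _

/-- **The gap at `Z ⊒ σ` is the gap at the oracle of its window assignment** (locality: the
machines read only strings of length `≤ reach n` of the `Z`-part). [cite: FennerFortnowKurtzLi2003IC, Thm. 6.13 (proof, p. 32) and §6.5 (p. 32)] -/
theorem gap_windowOracle_windowOf (hwf : Δ.WellFormed) {Z : Language Bool} (hZ : σ.ExtendedBy Z) (x : List Bool) :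
    Δ.gap B (Δ.windowOracle σ x.length (Δ.windowOf σ x.length Z)) x = Δ.gap B Z x :=
  Δ.gap_congr B fun t ht => Δ.mem_windowOracle_windowOf_iff hZ (Δ.zQueries_length_le hwf B Z x t ht)

/-- **Membership in `L(Δ^{B ⊕ Z})` is the value of the acceptance function at the window of `Z`**,
for well-formed `Δ` and `Z` extending `σ`. [cite: FennerFortnowKurtzLi2003IC, Thm. 6.13 (proof, p. 32) and Lemma 6.16] -/
theorem mem_lang_iff_winFn (hwf : Δ.WellFormed) {Z : Language Bool} (hZ : σ.ExtendedBy Z) (x : List Bool) :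
    x ∈ Δ.lang B Z ↔ Δ.winFn B σ x (Δ.windowOf σ x.length Z) = true := by
  rw [Δ.winFn_eq_true_iff B σ]
  show 2 * (2 : ℤ) ^ Δ.p.eval x.length ≤ 3 * Δ.gap B Z x ↔
    2 * (2 : ℤ) ^ Δ.p.eval x.length ≤ 3 * Δ.gap B (Δ.windowOracle σ x.length (Δ.windowOf σ x.length Z)) x
  rw [Δ.gap_windowOracle_windowOf hwf hZ x]

end AWPPDescr

end Literature.Barriers.QuantumAdvantage

end
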